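import Mathlib.Combinatorics.SimpleGraph.Girth
import Literature.Combinatorics.SimpleGraph.BrinkmannTuckerVanCleemput2021.G70
import HarnessLib

/-!
# `G70` has girth 5

Kochol's counterexamples and the graphs tested in Brinkmann–Tucker–Van Cleemput
[BrinkmannTuckerVancleemput2021, §3.1] are snarks: cyclically 4-edge-connected cubic graphs
that are not 3-edge-colourable and have girth `≥ 5` (p. 6).  This module certifies the girth of
`G70` (`…G70`, same directory): `G70.girth = 5` in Mathlib's sense (`girth_eq_five`), from two
kernel checks on the rotation table —
no two neighbours of a vertex are adjacent (`no_triangle`), and two distinct neighbours of a vertex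
have no common neighbour other than it (`no_quadrilateral`) — and the pentagonal face
`0, 20, 21, 14, 16`.  (Cyclic 4-edge-connectivity is certified by the bundle's stdlib checker, not
here.)

Provenance: refutations bundle `papers/_cross/refutations` (H21 seat pub-refute-2, 2026-08-18);
written for the tree under the Lean-in-tree rule (human 2026-08-18).
-/

namespace Literature.Combinatorics.SimpleGraph.BrinkmannTuckerVanCleemput2021

open _root_.SimpleGraph

/-- Kernel fact: no two rotation neighbours of a vertex are adjacent (no triangles). [folklore] -/
theorem no_triangle : ∀ (v : Fin 70) (i j : Fin 3), ¬ G70.Adj (rot v i) (rot v j) := by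
  decide +kernel

/-- Kernel fact: two distinct rotation neighbours of `v` have no common neighbour except `v`
(no quadrilaterals). [folklore] -/
theorem no_quadrilateral : ∀ (v : Fin 70) (i j : Fin 3), i ≠ j →
    ∀ k l : Fin 3, rot (rot v i) k = rot (rot v j) l → rot (rot v i) k = v := by
  decide +kernel

/-- Two neighbours of a vertex are not adjacent. [folklore] -/
theorem not_adj_of_adj_adj {a b c : Fin 70} (hba : G70.Adj b a) (hbc : G70.Adj b c) :
    ¬ G70.Adj a c := by
  obtain ⟨i, rfl⟩ := exists_rot_of_adj b a hba
  obtain ⟨j, rfl⟩ := exists_rot_of_adj b c hbc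
  exact no_triangle b i j

/-- A closed walk `a b c d a` with `a ≠ c` folds: `b = d` (no 4-cycles). [folklore] -/
theorem eq_of_adj_cycle_four {a b c d : Fin 70} (hab : G70.Adj a b) (hbc : G70.Adj b c)
    (hcd : G70.Adj c d) (hda : G70.Adj d a) (hac : a ≠ c) : b = d := by
  obtain ⟨i, rfl⟩ := exists_rot_of_adj a b hab
  obtain ⟨j, rfl⟩ := exists_rot_of_adj a d hda.symm
  by_contra hbd
  have hij : i ≠ j := fun h => hbd (h ▸ rfl)
  obtain ⟨k, rfl⟩ := exists_rot_of_adj (rot a i) c hbc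
  obtain ⟨l, hl⟩ := exists_rot_of_adj (rot a j) (rot (rot a i) k) hcd.symm
  exact hac (no_quadrilateral a i j hij k l hl.symm).symm

/-- Every cycle of `G70` has length at least `5`. [folklore] -/
theorem five_le_length_of_isCycle {a : Fin 70} (w : G70.Walk a a) (hw : w.IsCycle) :
    5 ≤ w.length := by
  have h3 := hw.three_le_length
  rcases w with _ | ⟨hab, w⟩
  · simp at h3
  rcases w with _ | ⟨hbc, w⟩
  · simp at h3
  rcases w with _ | ⟨hcd, w⟩
  · simp at h3
  rcases w with _ | ⟨hde, w⟩
  · exact absurd hcd.symm (not_adj_of_adj_adj hab.symm hbc)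
  rcases w with _ | ⟨hef, w⟩
  · have hn := hw.support_nodup
    simp only [Walk.support_cons, Walk.support_nil, List.tail_cons] at hn
    rename_i b c d
    have hca : c ≠ a := by
      rintro rfl
      simp [List.nodup_cons] at hn
    have hbd : b ≠ d := by
      rintro rfl
      simp [List.nodup_cons] at hn
    exact (hbd (eq_of_adj_cycle_four hab hbc hcd hde hca.symm)).elim
  · simp only [Walk.length_cons]
    omega

/-- The pentagonal face `0 → 20 → 21 → 14 → 16 → 0` as a closed walk. [folklore] -/
def pentagon : G70.Walk (0 : Fin 70) 0 :=
  Walk.cons (by decide : G70.Adj 0 20) <| Walk.cons (by decide : G70.Adj 20 21) <|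
    Walk.cons (by decide : G70.Adj 21 14) <| Walk.cons (by decide : G70.Adj 14 16) <|
      Walk.cons (by decide : G70.Adj 16 0) Walk.nil

/-- The pentagon is a cycle of length `5`. [folklore] -/
theorem pentagon_isCycle : pentagon.IsCycle ∧ pentagon.length = 5 := by
  refine ⟨?_, rfl⟩
  rw [Walk.isCycle_def]
  refine ⟨?_, by simp [pentagon], by decide⟩
  exact ⟨by decide⟩

/-- **`G70` has girth 5** (extended-natural version). [folklore] -/
theorem egirth_eq_five : G70.egirth = 5 := by
  refine le_antisymm ?_ ?_
  · have h := egirth_le_length pentagon_isCycle.1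
    rw [pentagon_isCycle.2] at h
    exact_mod_cast h
  · exact le_egirth.2 fun a w hw => by exact_mod_cast five_le_length_of_isCycle w hw

/-- **`G70` has girth 5.** [cite: BrinkmannTuckerVancleemput2021, §3.1] -/
theorem girth_eq_five : G70.girth = 5 := by
  rw [girth, egirth_eq_five]
  rfl

end Literature.Combinatorics.SimpleGraph.BrinkmannTuckerVanCleemput2021
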